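/-
Copyright (c) 2026. All rights reserved.
Released under Apache 2.0 license as described in the file LICENSE.
Authors: abc-iut cell, prover seat abc-iut-L4-d2 (gen 9).
-/
import Mathlib.Data.Real.Basic
import Literature.AnabelianGeometry.AbsoluteAnabelian.GaloisTheatersNumberFieldShadowTFPairsModel
import Literature.AnabelianGeometry.AbsoluteAnabelian.GaloisTheatersNumberFieldShadowRmk511
import Literature.AnabelianGeometry.AbsoluteAnabelian.TPairsRestrictionsJointlyMono
import Literature.AnabelianGeometry.AbsoluteAnabelian.PanalocalTPairs
import HarnessLib

/-!
# [AbsTopIII] Def 5.1 (vi) / Cor 5.2 (vi): `PanalocalTPairEssSurj` (F-3087) and `Cor52vi` (F-3092) REFUTED AS TYPED at the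
# print-shape `TF`-shadow vocabulary — through the ARCHIMEDEAN predicate

S. Mochizuki, *Topics in absolute anabelian geometry III* [MochizukiAbsTopIII2015], Def 5.1 (vi) p. 118 (the panalocalization
functor `Th⊚_T → Th✠_T` "is essentially surjective"), Def 4.1 (i) pp. 101–102 / (ii) p. 102 (Kummer structures;
Aut-holomorphic `T`-pairs — gloss: print's notion is again "isomorphic to a model pair", Def 4.1 (ii) (c): "for some model
Aut-holomorphic `T`-pair `(X_ell ↶κ M_k)` [where the notation is as in (i)], there exist an isomorphism `X_ell ⥲ X` of objects of
`TH` and an isomorphism `M_k ⥲ M` of objects of `T` that are compatible with the respective Kummer structures"), Cor 5.2 (vi)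
p. 120.  (v2: Def 4.1 item locator corrected to (ii) and quoted verbatim; theorems byte-identical to v1 p504531.)

The primed `TF`-shadow vocabulary `fieldShadowVocabulary' F` (abc-iut-L4-d2 g7, p493095) carries Def 3.1 (ii)'s print-shape
MLF-Galois-pair predicate at NONARCHIMEDEAN data, but — like the unprimed one — types "`(X ↶κ M)` is an Aut-holomorphic `TF`-pair"
at ARCHIMEDEAN data as the bare injectivity of the Kummer embedding `κ : M ↪ A_X` (Def 4.1 (i)), not as "isomorphic to a model
pair".  Consequently a panalocal `TF`-pair whose archimedean arithmetic data are `ℤ ↪ A_X` qualifies, and it is the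
panalocalization of NO global `TF`-pair: the panalocalization relation would identify `ℤ` with the archimedean datum `M_ṽ ≅ ℚ̄`
(reference isomorphism `ψ_ṽ` of Def 5.1 (v)) of the global pair by a RING ISOMORPHISM — but `2` is a unit in `ℚ̄` and not in `ℤ`.
THIS PROOF-ONLY FILE records

* **`not_panalocalTPairEssSurj_fieldShadow' : ¬ PanalocalTPairEssSurj (fieldShadowVocabulary' F)`** and
  **`not_cor52vi_fieldShadow' : ¬ Cor52vi (fieldShadowVocabulary' F)`** (F-3087 / F-3092 REFUTED AS TYPED there; the first two
  conjuncts of `Cor52vi` HOLD at this vocabulary — `panalocalTPairExists_fieldShadow'`, `panalocalTPairMapsHom_fieldShadow'`,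
  sibling files).

HONEST LABEL: refuted-as-typed at ONE instance, by the archimedean half of the typing (the nonarchimedean data of the witness are
GENUINE model pairs); the repair is a vocabulary whose Aut-holomorphic-pair predicate is print's "isomorphic to a model pair", at
which the row becomes EQUIVALENT to a local Galois rigidity statement at the nonarchimedean data (successor work, not here).
Shadow (`Δ = 1`) ≠ the genuine `(R, W)` (E-L4-13); refuted-as-typed ≠ refuted-in-print.  No `def`/`instance`/`structure`;
nothing here bears on [IUTchIII] Cor. 3.12 or takes a side; typed ≠ proved.
-/

noncomputable section

open scoped Pointwise Topology
open CategoryTheory NumberField Field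

namespace Literature.AnabelianGeometry.AbsoluteAnabelian

namespace NumberFieldShadow

variable (F : Type) [Field F] [NumberField F]

/-- **`PanalocalTPairEssSurj` (F-3087) is FALSE at the primed `TF`-shadow vocabulary `fieldShadowVocabulary' F`**: over a
panalocalization `V✠` of `V⊚(E_F)`, the panalocal `TF`-pair with GENUINE nonarchimedean data (the chart actions of the decomposition
groups on `ℚ̄`, model pairs in the sense of Def 3.1 (ii)) and archimedean data `ℤ ↪ A_{X_v}` (injective: `A_{X_v} ≅ ℂ`) is the
panalocalization of no global `TF`-pair `M⊚` — at an archimedean lift the relation composes with the reference isomorphism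
`ψ_ṽ : ℚ̄ ⥲ M_ṽ` to a ring isomorphism `ℚ̄ ≅ ℤ`, and `2` is a unit on the left only.  (Refuted-as-typed through the Aut-holomorphic
predicate `Injective κ`; print's Def 4.1 (ii) asks for a pair isomorphic to a model.) [cite: MochizukiAbsTopIII2015, Def 5.1 (vi) p.118] -/
theorem not_panalocalTPairEssSurj_fieldShadow' : ¬ PanalocalTPairEssSurj (fieldShadowVocabulary' F) := by
  intro h
  -- a panalocalization `V✠` of the theater `V⊚(E_F)`
  obtain ⟨V, E₀, hE₀, ψ₀, href₀⟩ :
      ∃ (V : PanalocalGaloisTheater (context F)) (E : FundamentalExtension.{0}) (_ : (context F).IsAdmissible E)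
        (ψ : (context F).ProValModAut E ≃ V.V), IsPanalocalReferenceFor (context F) V.generic V.non V.arc V.grp V.X E ψ := by
    obtain ⟨V, -⟩ := panalocalizationExists_context F (extension F) (isAdmissible_extension F)
    obtain ⟨E, hE, ψ, hψ⟩ := V.exists_reference
    exact ⟨V, E, hE, ψ, hψ⟩
  obtain ⟨-, -, -, hgrp, hX⟩ := href₀
  -- GENUINE nonarchimedean data: the chart action of `Π_{E₀,ṽ}` on `ℚ̄`, transported to `Π_v ≅ Π_{E₀,ṽ}` (model pairs)
  have hN : ∀ c : V.non, ∃ act : V.grp c →* Aut (CommRingCat.of (AlgebraicClosure ℚ)),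
      (fieldShadowVocabulary' F).IsMLFGaloisPair act := by
    intro c
    obtain ⟨vl, hvl, -, ⟨e⟩⟩ := hgrp c
    refine ⟨(fieldLocAct E₀ vl).comp e.toMulEquiv.toMonoidHom, ?_⟩
    refine IsShadowMLFGaloisTFPair.of_iso (isShadowMLFGaloisTFPair_fieldLocAct F hE₀ vl hvl) e (Iso.refl _) fun g => ?_
    change (fieldLocAct E₀ vl (e g)).hom ≫ 𝟙 _ = 𝟙 _ ≫ (fieldLocAct E₀ vl (e g)).hom
    rw [Category.comp_id, Category.id_comp]
  choose act hact using hN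
  -- archimedean data `ℤ ↪ A_{X_v}` (injective since `A_{X_v} ≅ ℂ` has characteristic zero)
  have hA : ∀ c : V.arc, Function.Injective (Int.castRingHom (V.X c).fieldA) := by
    intro c m n hmn
    obtain ⟨vl, -, ⟨x⟩⟩ := hX c
    have h' := congrArg x.fieldIso hmn
    change x.fieldIso ((m : (V.X c).fieldA)) = x.fieldIso ((n : (V.X c).fieldA)) at h'
    rw [map_intCast, map_intCast] at h'
    exact Int.cast_injective (α := ℂ) h'
  -- the panalocal `TF`-pair
  let Q : PanalocalTPair (fieldShadowVocabulary' F) :=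
    { theater := V
      data :=
        { Mnon := fun _ => CommRingCat.of (AlgebraicClosure ℚ)
          actNon := act
          isMLF := hact
          Marc := fun _ => CommRingCat.of ℤ
          kummer := fun c => Int.castRingHom (V.X c).fieldA
          isAutHol := hA } }
  -- suppose it is the panalocalization of a global `TF`-pair `M⊚`
  obtain ⟨M, ψV, hψV, ψ, href, -, hAC⟩ := h Q
  -- the reference structure of `M⊚` (its `ψ_V` IS the one of the relation, Rmk 5.1.1)
  obtain ⟨ψV', hψV', hnon, harc, ψg, ψnon, ψarc, -⟩ := M.exists_reference
  have hψ : ψV' = ψV := referenceIsoUnique_context F M.theater ψV' ψV hψV' hψV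
  subst hψ
  -- an archimedean local element `ṽ` of `Π_E`, `E := M.theater.ext`
  obtain ⟨vl, hvl⟩ := arc_proVal_nonempty F M.theater.ext
  have hvlV : ψV' vl ∈ M.theater.V.arc := harc ⟨vl, hvl⟩
  have hc : ψ ((context F).toModAut M.theater.ext vl) ∈ Q.theater.arc := href.2.2.1 vl hvl
  -- the relation at `ṽ` identifies `M_ṽ ≅ ℚ̄` with `ℤ`
  obtain ⟨-, φ, -⟩ := hAC vl hvlV hc
  let e : AlgebraicClosure ℚ ≃+* ℤ :=
    ((ψarc ⟨vl, hvl⟩ ≪≫ φ).commRingCatIsoToRingEquiv :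
      (CommRingCat.of (AlgebraicClosure ℚ) : CommRingCat.{0}) ≃+* (CommRingCat.of ℤ : CommRingCat.{0}))
  have h2 : IsUnit (e (2 : AlgebraicClosure ℚ)) := (isUnit_iff_ne_zero.mpr two_ne_zero).map e
  rw [map_ofNat] at h2
  rcases Int.isUnit_iff.mp h2 with h | h <;> norm_num at h

/-- **Cor 5.2 (vi) as one node (F-3092 `Cor52vi`) is FALSE at the primed `TF`-shadow vocabulary** — its third conjunct fails
(`not_panalocalTPairEssSurj_fieldShadow'`); the first two hold (`panalocalTPairExists_fieldShadow'`,
`panalocalTPairMapsHom_fieldShadow'`, sibling files).  Refuted-as-typed. [cite: MochizukiAbsTopIII2015, Cor 5.2 (vi) p.120] -/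
theorem not_cor52vi_fieldShadow' : ¬ Cor52vi (fieldShadowVocabulary' F) :=
  fun h => not_panalocalTPairEssSurj_fieldShadow' F h.2.2

end NumberFieldShadow

end Literature.AnabelianGeometry.AbsoluteAnabelian

end
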